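import Summits.Ventures.YMGap.RobustBall.GibbsOfCylinderDLR
import Summits.Ventures.YMGap.RobustBall.PerturbedExistence
import HarnessLib

/-!
# Venture YMGap, track ROBUST-BALL — ONE STATE, step 7: finite-volume Gibbs distributions with ARBITRARY
# boundary conditions converge to the unique DLR state (generic Feller specification on `SU(N)^{links(ℤ^d)}`)

HONEST FRAMING. WHAT THIS IS: a venture file (cell `pub-ymgap`, track Y2 ROBUST-BALL, seat ds-3), three generic
measure-theoretic statements about a specification `γ` on the compact metrisable configuration space
`LGConfig d G = (links of ℤ^d) → G` of a compact second-countable group `G` with the FELLER property (kernel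
averages of bounded continuous observables are continuous in the boundary condition — proved in the tree for
the Wilson kernels `ymSpecification` (`continuous_integral_ymSpecification`), for the perturbed kernels of every
member of the tier-1 ball (`continuous_integral_perturbedYM`) and of the tier-2 ball
(`continuous_integral_perturbedYMS`)):
* `isGibbsMeasure_of_tendsto_integral` — Georgii's Thm. 4.17 with ARBITRARY boundary data: if the finite-volume
  distributions `γ_{Λₙ}(· | ηₙ)` along volumes `Λₙ` eventually containing every finite link set, with ANY boundary
  conditions `ηₙ`, converge on bounded continuous observables to a probability measure `μ`, then `μ ∈ 𝒢(γ)`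
  (consistency `γ_{Λₙ}(γ_Δ F | ηₙ) = γ_{Λₙ}(F | ηₙ)` for `Δ ⊆ Λₙ`, Feller continuity of `γ_Δ F`, then the tree's
  `isGibbsMeasure_of_cylinderDLR`);
* `tendsto_integral_of_subsingleton` — ★ in the UNIQUENESS regime (`𝒢(γ) ⊆ {μ}`, `μ ∈ 𝒢(γ)`) the finite-volume
  distributions with ARBITRARY boundary conditions converge to `μ` along the FULL sequence:
  `∫ F dγ_{Λₙ}(· | ηₙ) → ∫ F dμ` for every bounded continuous `F`, every cofinal `(Λₙ)`, every `(ηₙ)` (every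
  subsequence has a weakly convergent sub-subsequence by compactness of the space of probability measures, whose
  limit is a DLR state by the first theorem, hence `μ`; Georgii 2011, Prop. 7.11 / Friedli–Velenik 2017,
  Lemma 6.30 for the idea);
* `eventually_forall_abs_sub_integral_lt` — ★ the same UNIFORMLY IN THE BOUNDARY CONDITION:
  `sup_η |∫ F dγ_{Λₙ}(· | η) − ∫ F dμ| → 0` (the Feller average attains its maximal deviation on the compact
  configuration space; apply the previous theorem to the maximisers).
WHAT THIS IS NOT: no lattice estimate, no rate of convergence (that is the Dobrushin comparison theorem's
business, ds-1's `StateLipschitz`), nothing about the continuum limit or the Clay Millennium problem.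

References: H.-O. Georgii, *Gibbs Measures and Phase Transitions* (2011), Thm. 4.17, (4.18), Prop. 7.11;
S. Friedli, Y. Velenik (2017), Thm. 6.26, Lemma 6.30; the tree's `PerturbedExistence.lean`
(`exists_isGibbsMeasure_of_feller`, followed line by line) and `GibbsOfCylinderDLR.lean`.
-/

noncomputable section

open MeasureTheory Filter Topology Function
open Literature.Probability.LatticeModels
open Literature.MathematicalPhysics.QuantumLattice
open Literature.MathematicalPhysics.QuantumFieldTheory hiding ZdEdge

namespace Summit.Ventures.YMGap.RobustBall

namespace BoundaryLimit

variable {d : ℕ} {G : Type*} [MeasurableSpace G]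

/-- Kernel averages of an observable bounded by `C` are bounded by `C`. [folklore] -/
theorem abs_integral_le_of_abs_le {γ : Specification (ZdEdge d) G} (hγ : IsSpecification γ)
    (Λ : Finset (ZdEdge d)) {F : LGConfig d G → ℝ} {C : ℝ} (hC : ∀ U, |F U| ≤ C) (η : LGConfig d G) :
    |∫ U, F U ∂(γ Λ η)| ≤ C := by
  haveI := hγ.isProbability Λ η
  have h := norm_integral_le_of_norm_le_const (μ := γ Λ η) (f := F) (C := C)
    (ae_of_all _ fun U => by simpa [Real.norm_eq_abs] using hC U)
  simpa [Real.norm_eq_abs] using h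

variable [TopologicalSpace G] [CompactSpace G] [BorelSpace G] [T2Space G] [SecondCountableTopology G]

/-! ### Compactness: every sequence of states has a weakly convergent subsequence -/

/-- **Compactness of the state space.** Every sequence of probability measures on `G^{links(ℤ^d)}` (compact
metrisable) has a subsequence converging on every bounded continuous observable to a probability measure
(Prokhorov / Riesz–Markov, Mathlib's compactness of `ProbabilityMeasure` on a compact space). [folklore] -/
theorem exists_subseq_tendsto_integral (ν : ℕ → Measure (LGConfig d G)) [∀ n, IsProbabilityMeasure (ν n)] :
    ∃ (φ : ℕ → ℕ) (μ : Measure (LGConfig d G)), StrictMono φ ∧ IsProbabilityMeasure μ ∧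
      ∀ F : LGConfig d G → ℝ, Continuous F → (∃ C, ∀ U, |F U| ≤ C) →
        Tendsto (fun k => ∫ U, F U ∂(ν (φ k))) atTop (𝓝 (∫ U, F U ∂μ)) := by
  let P : ℕ → ProbabilityMeasure (LGConfig d G) := fun n => ⟨ν n, inferInstance⟩
  obtain ⟨μ, -, φ, hφ, hlim⟩ :=
    (isCompact_univ (X := ProbabilityMeasure (LGConfig d G))).tendsto_subseq fun n => Set.mem_univ (P n)
  refine ⟨φ, (μ : Measure (LGConfig d G)), hφ, inferInstance, fun F hFc hFb => ?_⟩
  obtain ⟨C, hC⟩ := hFb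
  let Fb : BoundedContinuousFunction (LGConfig d G) ℝ :=
    BoundedContinuousFunction.ofNormedAddCommGroup F hFc C (fun U => by simpa [Real.norm_eq_abs] using hC U)
  exact (ProbabilityMeasure.tendsto_iff_forall_integral_tendsto.1 hlim) Fb

omit [MeasurableSpace G] [BorelSpace G] [T2Space G] [SecondCountableTopology G] in
/-- On the compact configuration space a continuous real function attains its supremum. [folklore] -/
theorem exists_forall_le_of_continuous [Nonempty G] {g : LGConfig d G → ℝ} (hg : Continuous g) :
    ∃ η₀ : LGConfig d G, ∀ η, g η ≤ g η₀ := by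
  obtain ⟨η₀, -, h⟩ := isCompact_univ.exists_isMaxOn Set.univ_nonempty hg.continuousOn
  exact ⟨η₀, fun η => h (Set.mem_univ η)⟩

/-! ### Limits of finite-volume distributions with arbitrary boundary conditions are DLR states -/

variable [Group G] [IsTopologicalGroup G]

omit [CompactSpace G] [T2Space G] in
/-- **Georgii's Theorem 4.17 with ARBITRARY boundary conditions.** Let `γ` be a Feller specification on
`G^{links(ℤ^d)}`, `(Λₙ)` finite link sets eventually containing every finite set, `(ηₙ)` ANY boundary conditions,
and `μ` a probability measure with `∫ F dγ_{Λₙ}(· | ηₙ) → ∫ F dμ` for every bounded continuous `F`. Then `μ` is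
a Gibbs measure of `γ`: for `Δ ⊆ Λₙ` consistency gives `γ_{Λₙ}(γ_Δ F | ηₙ) = γ_{Λₙ}(F | ηₙ)`, `γ_Δ F` is bounded
continuous (Feller), so `μ(γ_Δ F) = μ(F)` — the cylinder DLR equations, which imply `μ ∈ 𝒢(γ)`
(`isGibbsMeasure_of_cylinderDLR`) (Georgii 2011, Thm. 4.17 / (4.18); Friedli–Velenik 2017, Thm. 6.26). [folklore] -/
theorem isGibbsMeasure_of_tendsto_integral {γ : Specification (ZdEdge d) G} (hγ : IsSpecification γ)
    (hFeller : ∀ (Λ : Finset (ZdEdge d)) (F : LGConfig d G → ℝ), Continuous F → ∀ C : ℝ,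
      (∀ U, |F U| ≤ C) → Continuous fun η => ∫ U, F U ∂(γ Λ η))
    {Λs : ℕ → Finset (ZdEdge d)} (hcof : ∀ Δ : Finset (ZdEdge d), ∀ᶠ n in atTop, Δ ⊆ Λs n)
    (ηs : ℕ → LGConfig d G) {μ : Measure (LGConfig d G)} [IsProbabilityMeasure μ]
    (hlim : ∀ F : LGConfig d G → ℝ, Continuous F → (∃ C, ∀ U, |F U| ≤ C) →
      Tendsto (fun n => ∫ U, F U ∂(γ (Λs n) (ηs n))) atTop (𝓝 (∫ U, F U ∂μ))) :
    IsGibbsMeasure γ μ := by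
  haveI hprob : ∀ Λ η, IsProbabilityMeasure (γ Λ η) := hγ.isProbability
  refine isGibbsMeasure_of_cylinderDLR hγ hFeller fun Δ F _ _ hFc C hC => ?_
  have h1 := hlim F hFc ⟨C, hC⟩
  have h2 := hlim (fun η => ∫ U, F U ∂(γ Δ η)) (hFeller Δ F hFc C hC)
    ⟨C, abs_integral_le_of_abs_le hγ Δ hC⟩
  have hev : ∀ᶠ n in atTop,
      ∫ U, F U ∂(γ (Λs n) (ηs n)) = ∫ η, (∫ U, F U ∂(γ Δ η)) ∂(γ (Λs n) (ηs n)) := by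
    filter_upwards [hcof Δ] with n hn
    exact (integral_integral_consistent hγ hn (ηs n)
      (integrable_of_bound hFc.measurable.aestronglyMeasurable hC)).symm
  exact tendsto_nhds_unique (h1.congr' hev) h2

/-! ### Uniqueness regime: the full sequence converges, for every boundary condition -/

/-- ★ **UNIQUENESS ⇒ CONVERGENCE FOR ARBITRARY BOUNDARY CONDITIONS.** Let `γ` be a Feller specification on
`G^{links(ℤ^d)}` whose Gibbs measures form a subsingleton containing `μ`. Then for EVERY sequence of finite link
volumes `(Λₙ)` eventually containing every finite set and EVERY sequence of boundary conditions `(ηₙ)`, the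
finite-volume Gibbs distributions converge to `μ` along the FULL sequence: `∫ F dγ_{Λₙ}(· | ηₙ) → ∫ F dμ` for
every bounded continuous observable `F` (every subsequence has a weakly convergent sub-subsequence — compactness
—, its limit is a DLR state — `isGibbsMeasure_of_tendsto_integral` —, hence `μ`) (Georgii 2011, Prop. 7.11 with
Thm. 4.17; Friedli–Velenik 2017, Lemma 6.30). [folklore] -/
theorem tendsto_integral_of_subsingleton {γ : Specification (ZdEdge d) G} (hγ : IsSpecification γ)
    (hFeller : ∀ (Λ : Finset (ZdEdge d)) (F : LGConfig d G → ℝ), Continuous F → ∀ C : ℝ,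
      (∀ U, |F U| ≤ C) → Continuous fun η => ∫ U, F U ∂(γ Λ η))
    (hsub : (gibbsMeasures γ).Subsingleton) {μ : Measure (LGConfig d G)} (hμ : μ ∈ gibbsMeasures γ)
    {Λs : ℕ → Finset (ZdEdge d)} (hcof : ∀ Δ : Finset (ZdEdge d), ∀ᶠ n in atTop, Δ ⊆ Λs n)
    (ηs : ℕ → LGConfig d G) {F : LGConfig d G → ℝ} (hFc : Continuous F) (hFb : ∃ C, ∀ U, |F U| ≤ C) :
    Tendsto (fun n => ∫ U, F U ∂(γ (Λs n) (ηs n))) atTop (𝓝 (∫ U, F U ∂μ)) := by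
  haveI hprob : ∀ Λ η, IsProbabilityMeasure (γ Λ η) := hγ.isProbability
  refine tendsto_of_subseq_tendsto fun ns hns => ?_
  obtain ⟨φ, ν, hφ, hνprob, hν⟩ := exists_subseq_tendsto_integral (fun k => γ (Λs (ns k)) (ηs (ns k)))
  haveI := hνprob
  refine ⟨φ, ?_⟩
  have hcof' : ∀ Δ : Finset (ZdEdge d), ∀ᶠ k in atTop, Δ ⊆ Λs (ns (φ k)) := fun Δ =>
    (hns.comp hφ.tendsto_atTop).eventually (hcof Δ)
  have hνG : IsGibbsMeasure γ ν :=
    isGibbsMeasure_of_tendsto_integral hγ hFeller (Λs := fun k => Λs (ns (φ k))) hcof'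
      (fun k => ηs (ns (φ k))) hν
  rw [← hsub hνG hμ]
  exact hν F hFc hFb

/-- ★ **UNIFORMLY IN THE BOUNDARY CONDITION.** In the setting of `tendsto_integral_of_subsingleton`: for every
bounded continuous `F` and every `ε > 0`, for all large `n` and ALL boundary conditions `η` simultaneously,
`|∫ F dγ_{Λₙ}(· | η) − ∫ F dμ| < ε` — i.e. `sup_η |γ_{Λₙ}(F | η) − μ(F)| → 0` (the deviation is a continuous
function of `η` by the Feller property and attains its maximum on the compact configuration space; apply the
sequence theorem to the maximisers) (Georgii 2011, Prop. 7.11 (c); Friedli–Velenik 2017, Lemma 6.30). [folklore] -/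
theorem eventually_forall_abs_sub_integral_lt {γ : Specification (ZdEdge d) G}
    (hγ : IsSpecification γ)
    (hFeller : ∀ (Λ : Finset (ZdEdge d)) (F : LGConfig d G → ℝ), Continuous F → ∀ C : ℝ,
      (∀ U, |F U| ≤ C) → Continuous fun η => ∫ U, F U ∂(γ Λ η))
    (hsub : (gibbsMeasures γ).Subsingleton) {μ : Measure (LGConfig d G)} (hμ : μ ∈ gibbsMeasures γ)
    {Λs : ℕ → Finset (ZdEdge d)} (hcof : ∀ Δ : Finset (ZdEdge d), ∀ᶠ n in atTop, Δ ⊆ Λs n)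
    {F : LGConfig d G → ℝ} (hFc : Continuous F) (hFb : ∃ C, ∀ U, |F U| ≤ C) {ε : ℝ} (hε : 0 < ε) :
    ∀ᶠ n in atTop, ∀ η : LGConfig d G, |∫ U, F U ∂(γ (Λs n) η) - ∫ U, F U ∂μ| < ε := by
  obtain ⟨C, hC⟩ := hFb
  -- the deviation is continuous in the boundary condition, hence attains its maximum at some `ηₙ`
  have hdev : ∀ n, Continuous fun η => |∫ U, F U ∂(γ (Λs n) η) - ∫ U, F U ∂μ| := fun n =>
    ((hFeller (Λs n) F hFc C hC).sub continuous_const).abs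
  choose ηs hηs using fun n => exists_forall_le_of_continuous (hdev n)
  have hlim := tendsto_integral_of_subsingleton hγ hFeller hsub hμ hcof ηs hFc ⟨C, hC⟩
  have h0 : Tendsto (fun n => |∫ U, F U ∂(γ (Λs n) (ηs n)) - ∫ U, F U ∂μ|) atTop (𝓝 0) := by
    have h := (hlim.sub_const (∫ U, F U ∂μ)).abs
    simpa using h
  filter_upwards [h0.eventually (gt_mem_nhds hε)] with n hn η
  exact (hηs n η).trans_lt hn

/-- **An exhaustion is cofinal**: for the record, sequences `(Λₙ)` as in the theorems above exist (the tree's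
`exists_exhaustion`), so the hypotheses are never vacuous; and any sequence containing an exhaustion termwise
is again cofinal. [folklore] -/
theorem cofinal_of_subset {Λs Λs' : ℕ → Finset (ZdEdge d)}
    (hcof : ∀ Δ : Finset (ZdEdge d), ∀ᶠ n in atTop, Δ ⊆ Λs n) (h : ∀ n, Λs n ⊆ Λs' n) :
    ∀ Δ : Finset (ZdEdge d), ∀ᶠ n in atTop, Δ ⊆ Λs' n := fun Δ =>
  (hcof Δ).mono fun n hn => hn.trans (h n)

/-- **Centred cubes of links are cofinal**: `Λ_L = [−L, L]^d × (all directions)`, `L → ∞`, eventually contains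
every finite link set — the standard van Hove sequence of the cell's finite-volume statements
(`stub_boxInfluence_inward` uses the same cubes). [folklore] -/
theorem cofinal_cube :
    ∀ Δ : Finset (ZdEdge d), ∀ᶠ L : ℕ in atTop,
      Δ ⊆ (Fintype.piFinset fun _ : Fin d => Finset.Icc (-(L : ℤ)) (L : ℤ)) ×ˢ (Finset.univ : Finset (Fin d)) := by
  intro Δ
  refine Filter.eventually_atTop.2 ⟨(Δ.image fun e => Finset.univ.sup fun i => (e.1 i).natAbs).sup id, ?_⟩
  intro L hL e he
  rw [Finset.mem_product]
  refine ⟨Fintype.mem_piFinset.2 fun i => Finset.mem_Icc.2 ?_, Finset.mem_univ _⟩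
  have h1 : (e.1 i).natAbs ≤ Finset.univ.sup fun j => (e.1 j).natAbs :=
    Finset.le_sup (f := fun j => (e.1 j).natAbs) (Finset.mem_univ i)
  have h2 : (Finset.univ.sup fun j => (e.1 j).natAbs) ≤
      (Δ.image fun e => Finset.univ.sup fun i => (e.1 i).natAbs).sup id :=
    Finset.le_sup (f := id) (Finset.mem_image_of_mem _ he)
  have h3 : (e.1 i).natAbs ≤ L := h1.trans (h2.trans hL)
  constructor <;> omega

/-! ### Appendix (ds-3 g11, same day): the net `Λ ↑ ℤ^d` of all finite volumes -/

/-- ★ **UNIFORMLY IN THE BOUNDARY CONDITION, ALONG THE NET OF ALL FINITE VOLUMES `Λ ↑ ℤ^d`** (no sequence chosen):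
in the setting of `tendsto_integral_of_subsingleton`, for every bounded continuous `F` and every `ε > 0`, for all sufficiently
large finite link sets `Λ` (Mathlib's `atTop` filter of `Finset (ZdEdge d)` under inclusion) and ALL boundary conditions `η`,
`|∫ F dγ_Λ(· | η) − ∫ F dμ| < ε`. Proof: otherwise there are arbitrarily large bad volumes; choosing one above each set of an
exhaustion gives a cofinal SEQUENCE of bad volumes, contradicting `eventually_forall_abs_sub_integral_lt`
(Georgii 2011, Prop. 7.11 (c)). [folklore] -/
theorem eventually_atTop_forall_abs_sub_integral_lt {γ : Specification (ZdEdge d) G} (hγ : IsSpecification γ)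
    (hFeller : ∀ (Λ : Finset (ZdEdge d)) (F : LGConfig d G → ℝ), Continuous F → ∀ C : ℝ,
      (∀ U, |F U| ≤ C) → Continuous fun η => ∫ U, F U ∂(γ Λ η))
    (hsub : (gibbsMeasures γ).Subsingleton) {μ : Measure (LGConfig d G)} (hμ : μ ∈ gibbsMeasures γ)
    {F : LGConfig d G → ℝ} (hFc : Continuous F) (hFb : ∃ C, ∀ U, |F U| ≤ C) {ε : ℝ} (hε : 0 < ε) :
    ∀ᶠ Λ : Finset (ZdEdge d) in atTop, ∀ η : LGConfig d G, |∫ U, F U ∂(γ Λ η) - ∫ U, F U ∂μ| < ε := by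
  by_contra hnot
  rw [Filter.not_eventually] at hnot
  obtain ⟨E, hE⟩ := exists_exhaustion d
  have hch : ∀ n : ℕ, ∃ Λ : Finset (ZdEdge d), E n ⊆ Λ ∧
      ¬ ∀ η : LGConfig d G, |∫ U, F U ∂(γ Λ η) - ∫ U, F U ∂μ| < ε := fun n => by
    obtain ⟨Λ, hΛ, h⟩ := Filter.frequently_atTop.1 hnot (E n)
    exact ⟨Λ, hΛ, h⟩
  choose Λs hΛsE hΛs using hch
  have hcof : ∀ Δ : Finset (ZdEdge d), ∀ᶠ n in atTop, Δ ⊆ Λs n := fun Δ =>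
    (hE Δ).mono fun n hn => hn.trans (hΛsE n)
  obtain ⟨n, hn⟩ := (eventually_forall_abs_sub_integral_lt hγ hFeller hsub hμ hcof hFc hFb hε).exists
  exact hΛs n hn

/-- ★ **CONVERGENCE ALONG THE NET `Λ ↑ ℤ^d` WITH AN ARBITRARY BOUNDARY CONDITION IN EACH VOLUME**: for any assignment
`Λ ↦ η_Λ` of boundary conditions, `∫ F dγ_Λ(· | η_Λ) → ∫ F dμ` along the directed set of finite volumes (Georgii 2011,
Prop. 7.11). [folklore] -/
theorem tendsto_integral_atTop_of_subsingleton {γ : Specification (ZdEdge d) G} (hγ : IsSpecification γ)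
    (hFeller : ∀ (Λ : Finset (ZdEdge d)) (F : LGConfig d G → ℝ), Continuous F → ∀ C : ℝ,
      (∀ U, |F U| ≤ C) → Continuous fun η => ∫ U, F U ∂(γ Λ η))
    (hsub : (gibbsMeasures γ).Subsingleton) {μ : Measure (LGConfig d G)} (hμ : μ ∈ gibbsMeasures γ)
    (ηΛ : Finset (ZdEdge d) → LGConfig d G) {F : LGConfig d G → ℝ} (hFc : Continuous F) (hFb : ∃ C, ∀ U, |F U| ≤ C) :
    Tendsto (fun Λ : Finset (ZdEdge d) => ∫ U, F U ∂(γ Λ (ηΛ Λ))) atTop (𝓝 (∫ U, F U ∂μ)) :=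
  Metric.tendsto_nhds.2 fun _ hε =>
    (eventually_atTop_forall_abs_sub_integral_lt hγ hFeller hsub hμ hFc hFb hε).mono fun Λ h => by
      rw [Real.dist_eq]; exact h (ηΛ Λ)

end BoundaryLimit

end Summit.Ventures.YMGap.RobustBall

end
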